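import Mathlib
import Literature.Probability.LatticeModels.GKSInequalities
import Literature.Probability.LatticeModels.CorrelationInequalitiesProofs
import Literature.Probability.LatticeModels.CouplingPathCalculus
import Summits.CriticalPhenomena.Ising3DConformalLimit.Theses.PrecisionLaplacian
import HarnessLib

/-!
# Crux `PrecisionLaplacian.InverseMFerromagnet` (stmt-CriticalPhenomena-4798) — line `magnetization-domination`
# (strategist s2, 2026-08-17): the crux as the linearisation at zero field of a NONLINEAR DOMINATION PRINCIPLE
# for the magnetisation map `h ↦ m(h)` of the pair ferromagnet in a nonnegative external field.

THE CRUX (IM).  For a finite zero-field pair ferromagnet (`gksExpect univ K C`, `K ≥ 0`, `|C i| = 2`) with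
second-moment matrix `Σ_{pq} = ⟨σ_pσ_q⟩`, every off-diagonal entry of `Σ⁻¹` is `≤ 0`.

THE LINE (dictionary with classical potential theory: kernel `Σ` ↦ the Gibbs response `h ↦ m(h) = ∇ log Z(h)`;
charge ↦ external field `h ≥ 0`; potential `Σa` ↦ magnetisation profile `m(h)`; Cartan–Choquet–Deny domination
principle ↦ MDP below; "inverse of the kernel is a Z-matrix" ↦ IM).  External fields are interaction terms on
singletons, so `m_x(h) = gksExpect univ (Sum.elim K h) (Sum.elim C ({·})) (spinAt x)` is a tree object.
* D1 `stub_mdp` (MAGNETISATION DOMINATION PRINCIPLE, the load-bearing stub; a Transfer, C⁺ ⇒ IM):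
  for nonnegative fields `A`, `B` with disjoint supports, if `B` out-magnetises `A` at every source of `A`
  (`m_x(A) ≤ m_x(B)` whenever `A_x > 0`) then `B` out-magnetises `A` everywhere.
  `|supp A| = 1` is GKS II exactly (`m_x(a·δ_p) = ⟨σ_xσ_p⟩₀ · tanh a` and `m_x(B) ≥ ⟨σ_xσ_p⟩_B m_p(B)`); the
  content starts at two sources.
* D2 `stub_mdp_linearise` — **PROVED in this file (v3, 2026-08-17; no sorry; name kept for the registry)**: MDP for
  `(K, C)` ⇒ the STRICT (linear) domination principle for `Σ` (strict hypothesis `(Σg)_x < 0` on `{g > 0}`, so that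
  first-order Taylor at zero field decides):
  `[(Σg)_x ≤ 0 at every x with g_x > 0] ⇒ Σg ≤ 0` — apply MDP to `A = εg⁺`, `B = ε(1+δ)g⁻` and let
  `ε → 0`, `δ → 0` (`m(εh) = εΣh + o(ε)` because `⟨σ_x⟩₀ = 0` for pair supports,
  `gksSum_spinAt_eq_zero_of_even_supp`, and `d/dt gksExpect` along a coupling path is the truncated correlation,
  `hasDerivAt_gksExpect_cplAt_cov_spinProduct`; strictness from `Σ_xx = 1`, `Σ ≥ 0`, GKS I).
* D3 `dp_inverse_offdiag_nonpos` (PROVED in this file, no sorry; Choquet–Deny direction): a real matrix with the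
  domination principle has an inverse with nonpositive off-diagonal entries (test vector
  `g = S⁻¹(e_x − τ e_y)`, `τ = |S⁻¹xx|/S⁻¹xy + 1`; a singular `S` has `S⁻¹ = 0` in Mathlib).
* Composition `InverseMFerromagnet_of`: D3 ∘ D2 ∘ D1, the crux BY NAME; the ONLY sorry left is D1 (`stub_mdp`, MDP).

WHY EASIER / WHAT IT EXPOSES (Transfer).  MDP is a statement about ONE-point functions at FINITE nonnegative
fields — the regime where the ferromagnetic toolbox acts natively (GKS/GHS/FKG, random currents with sources,
Lee–Yang), whereas IM is an infinitesimal statement about the inverse of the 2-point matrix on which no correlation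
inequality acts directly (every registered normal form Law₂ ≡ CPL ≡ AMP ≡ SP ≡ POS-v route is second-order algebra).
Concretely it opens three attacks that have no infinitesimal counterpart: (a) the LATTICE route — MDP follows from
submodularity of the Gibbs potential `G = (log Z)^*` on pairs of positively-tilted profiles,
`G(u ∧ v) + G(u ∨ v) ≤ G(u) + G(v)` for `u = m(A)`, `v = m(B)` (SUBMOD; `G(w) = min {D(ν ‖ μ₀) : E_ν σ = w}` is an
I-projection value, so SUBMOD is an entropy inequality for couplings of two FKG tilts; numerically clean, see card);
(b) Rheinboldt–Moré M-FUNCTION theory (`T = ∇G` is an M-function iff off-diagonally antitone P-function; then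
`T'` is an M-matrix wherever nonsingular — Hubbard 1976 pp. 250–254, Thm 3.1(g), 3.6(c,d)), which replaces the
sign of one matrix entry by order properties of a monotone gradient map along paths; (c) an internal LADDER by the
number of sources `|supp A|` whose first rung is GKS II and whose step is a one-site Möbius-addition recursion
`m_x(A ⊕_p τ) = (m_x + τ⟨σ_xσ_p⟩_A)/(1 + τ m_p)`.
HONEST RISK: MDP ⇒ IM is cheap (D2–D3) and IM ⇒ "∇²G is a Z-matrix on M⁺ = m(ℝⁿ₊)"; the converse direction
IM ⇒ MDP is NOT cheap because M⁺ is not order-convex (numerics: the lattice operations leave M⁺ in ≈ 50% of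
pairs, and the Z-property of ∇²G FAILS off M⁺ — 830/2700 box profiles), so MDP is a genuine strengthening that
could die while IM lives; and none of (a)–(c) is a proof yet.
EVIDENCE (this seat, exact enumeration, exp/*.py): MDP/GCP 0 violations in 2000 random instances n ≤ 9
(5 coupling regimes, disjoint/overlapping/nested supports) + ≈ 550 annealing chains × 120 steps n ≤ 7 (best
ratio of crossing thresholds non-qualifying/qualifying = 1 to 9 digits: ties at separators only); SUBMOD 0
violations in 276 random pairs + ≈ 10 000 annealing chains n ≤ 6 (min normalised slack −2e−11 = solver noise);
BOX-Z (Z-Hessian of G on the whole box [0,1)ⁿ) FALSE (worst relative positive entry 0.16); UFM (monotonicity of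
the field-precision along uniform fields) FALSE; IM on K_{n,m} to n = m = 2000 clean with relative margin → 0 like
1/n at K_c and 1/n² inside the Gaussian regime (asymptotically tight family).

DISPROOF USED (`Cruxes/InverseMFerromagnet/Disproof.lean` v6): `inverseM_false_without_nonneg` — `K ≥ 0` is a
hypothesis of D1 and is used (MDP with a negative bond fails already for two sources: gauge-flip = BOX-Z failures);
`inverseM_false_without_pair` — `|C i| = 2` is a hypothesis of D1 AND of D2 (evenness gives `m(0) = 0`, so the
linearisation is `Σ`; for a 4-set support MDP must fail since IM does); `not_precisionAntitone` — no monotonicity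
in couplings or temperature is used anywhere (fields only; and UFM, the field analogue, is recorded false, unused);
`inverseM_tight_at_twoSeparator` — respected: MDP is tight exactly at separator degeneracies (the observed ties);
`inverseM_of_le_three` — the GKS rung.  No `-- Targets` section and no landed `Negative/` lemma bears on one-point
functions in a field.
-/

namespace Summit.CriticalPhenomena.Ising3DConformalLimit.Cruxes.InverseMFerromagnet.MagnetizationDomination

open Literature.Probability.LatticeModels Finset Matrix Filter Topology
open Summit.CriticalPhenomena.Ising3DConformalLimit.Theses.PrecisionLaplacian (InverseMFerromagnet)

noncomputable section

/-- The magnetisation `m_x(h) = ⟨σ_x⟩_{K,C;h}` of the spin system `(K, C)` on `Fin n` in the external field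
`h : Fin n → ℝ`, realised inside the Friedli–Velenik class by adjoining the singleton interactions `h_y σ_y`
(index type `Fin m ⊕ Fin n`). [folklore] -/
def mag (n m : ℕ) (K : Fin m → ℝ) (C : Fin m → Finset (Fin n)) (h : Fin n → ℝ) (x : Fin n) : ℝ :=
  gksExpect (Finset.univ : Finset (Fin m ⊕ Fin n)) (Sum.elim K h) (Sum.elim C fun y => ({y} : Finset (Fin n)))
    (spinAt x)

/-- The zero-field second-moment matrix `Σ_{pq} = ⟨σ_pσ_q⟩_{K,C}` (verbatim the matrix of the crux). [folklore] -/
def secondMoment (n m : ℕ) (K : Fin m → ℝ) (C : Fin m → Finset (Fin n)) : Matrix (Fin n) (Fin n) ℝ :=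
  Matrix.of fun (p q : Fin n) => gksExpect Finset.univ K C (fun ω => spinAt p ω * spinAt q ω)

/-- **D1 · magnetisation domination principle (MDP)** — the load-bearing stub (Transfer target, C⁺ ⇒ IM).
For a finite pair ferromagnet (`K ≥ 0`, `|C i| = 2`) and nonnegative external fields `A`, `B` with disjoint
supports: if `m_x(A) ≤ m_x(B)` at every source `x` of `A` (`A_x > 0`), then `m_x(A) ≤ m_x(B)` at every site.
Nonlinear analogue of the Cartan–Choquet–Deny domination principle; `|supp A| = 1` is GKS II; its linearisation at
zero field is the domination principle for `Σ` (D2), i.e. IM (D3).  Stated inline over tree declarations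
(`mag` unfolds to the displayed `gksExpect`). [folklore] -/
theorem stub_mdp :
    ∀ (n m : ℕ) (K : Fin m → ℝ) (C : Fin m → Finset (Fin n)), (∀ i, 0 ≤ K i) → (∀ i, (C i).card = 2) →
      ∀ A B : Fin n → ℝ, (∀ x, 0 ≤ A x) → (∀ x, 0 ≤ B x) → (∀ x, A x = 0 ∨ B x = 0) →
      (∀ x, 0 < A x →
        gksExpect (Finset.univ : Finset (Fin m ⊕ Fin n)) (Sum.elim K A) (Sum.elim C fun y => ({y} : Finset (Fin n)))
            (spinAt x) ≤
          gksExpect (Finset.univ : Finset (Fin m ⊕ Fin n)) (Sum.elim K B) (Sum.elim C fun y => ({y} : Finset (Fin n)))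
            (spinAt x)) →
      ∀ x,
        gksExpect (Finset.univ : Finset (Fin m ⊕ Fin n)) (Sum.elim K A) (Sum.elim C fun y => ({y} : Finset (Fin n)))
            (spinAt x) ≤
          gksExpect (Finset.univ : Finset (Fin m ⊕ Fin n)) (Sum.elim K B) (Sum.elim C fun y => ({y} : Finset (Fin n)))
            (spinAt x) := by
  sorry

/-! ### D2 PROVED (v3): helper lemmas for the zero-field linearisation (reindexing, oddness, field derivative). -/

variable (n m : ℕ) (K : Fin m → ℝ) (C : Fin m → Finset (Fin n))

/-- Step 1: with zero field couplings the adjoined singleton terms do not change the weight. -/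
theorem gksWeight_sumElim_zero (F : Fin n → ℝ) (hF : ∀ y, F y = 0) (ω : SpinConfig (Fin n)) :
    gksWeight (Finset.univ : Finset (Fin m ⊕ Fin n)) (Sum.elim K F) (Sum.elim C fun y => ({y} : Finset (Fin n))) ω =
      gksWeight (Finset.univ : Finset (Fin m)) K C ω := by
  simp [gksWeight, gksHamiltonian, Fintype.sum_sum_type, hF]

theorem gksSum_sumElim_zero (F : Fin n → ℝ) (hF : ∀ y, F y = 0) (f : SpinConfig (Fin n) → ℝ) :
    gksSum (Finset.univ : Finset (Fin m ⊕ Fin n)) (Sum.elim K F) (Sum.elim C fun y => ({y} : Finset (Fin n))) f =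
      gksSum (Finset.univ : Finset (Fin m)) K C f := by
  simp [gksSum, gksWeight_sumElim_zero n m K C F hF]

theorem gksExpect_sumElim_zero (F : Fin n → ℝ) (hF : ∀ y, F y = 0) (f : SpinConfig (Fin n) → ℝ) :
    gksExpect (Finset.univ : Finset (Fin m ⊕ Fin n)) (Sum.elim K F) (Sum.elim C fun y => ({y} : Finset (Fin n))) f =
      gksExpect (Finset.univ : Finset (Fin m)) K C f := by
  simp [gksExpect, gksSum_sumElim_zero n m K C F hF]

/-- Step 2: oddness at zero field in the adjoined system (pair supports even, field couplings zero). -/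
theorem gksExpect_spinAt_zero (hC : ∀ i, (C i).card = 2) (F : Fin n → ℝ) (hF : ∀ y, F y = 0) (u : Fin n) :
    gksExpect (Finset.univ : Finset (Fin m ⊕ Fin n)) (Sum.elim K F) (Sum.elim C fun y => ({y} : Finset (Fin n))) (spinAt u) = 0 := by
  have h := gksSum_spinAt_eq_zero_of_even_supp (Finset.univ : Finset (Fin m ⊕ Fin n)) (Sum.elim K F)
    (Sum.elim C fun y => ({y} : Finset (Fin n)))
    (by
      intro i _
      rcases i with i | y
      · right; simp [hC i]
      · left; simp [hF y]) u
  simp only [gksExpect]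
  rw [show (spinAt u : SpinConfig (Fin n) → ℝ) = fun σ => spinAt u σ from rfl, h, zero_div]

/-- the field terms: the image of `Sum.inr` -/
def fieldTerms : Finset (Fin m ⊕ Fin n) := Finset.univ.map ⟨Sum.inr, Sum.inr_injective⟩

theorem sumElim_smul_eq_cplAt (h : Fin n → ℝ) (t : ℝ) :
    Sum.elim K (t • h) = cplAt (Sum.elim K h) (fieldTerms n m) t := by
  funext i
  rcases i with i | y
  · simp [cplAt, fieldTerms]
  · simp [cplAt, fieldTerms]

/-- Step 3: `d/dt|_{t=0} m_x(t h) = (Σ h)_x`. -/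
theorem hasDerivAt_mag_smul_zero (hC : ∀ i, (C i).card = 2) (h : Fin n → ℝ) (x : Fin n) :
    HasDerivAt (fun t : ℝ => mag n m K C (t • h) x) ((secondMoment n m K C).mulVec h x) (0 : ℝ) := by
  have hd := hasDerivAt_gksExpect_cplAt_cov_spinProduct (Finset.univ : Finset (Fin m ⊕ Fin n)) (Sum.elim K h)
    (Sum.elim C fun y => ({y} : Finset (Fin n))) (fieldTerms n m) (Finset.subset_univ _) (spinAt x) 0
  have hfun : (fun t : ℝ => mag n m K C (t • h) x) =
      fun t : ℝ => gksExpect Finset.univ (cplAt (Sum.elim K h) (fieldTerms n m) t) (Sum.elim C fun y => ({y} : Finset (Fin n))) (spinAt x) := by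
    funext t; simp only [mag, sumElim_smul_eq_cplAt]
  rw [hfun]
  refine hd.congr_deriv ?_
  rw [← sumElim_smul_eq_cplAt n m K h 0]
  have hF : ∀ y, ((0 : ℝ) • h) y = 0 := fun y => by simp
  rw [fieldTerms, Finset.sum_map]
  simp only [Function.Embedding.coeFn_mk, Sum.elim_inr]
  have hodd := gksExpect_spinAt_zero n m K C hC ((0 : ℝ) • h) hF x
  rw [hodd]
  simp only [zero_mul, sub_zero]
  have hre : ∀ y, gksExpect (Finset.univ : Finset (Fin m ⊕ Fin n)) (Sum.elim K ((0 : ℝ) • h)) (Sum.elim C fun y => ({y} : Finset (Fin n)))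
      (fun ω => spinAt x ω * spinProduct ({y} : Finset (Fin n)) ω) =
      gksExpect Finset.univ K C (fun ω => spinAt x ω * spinAt y ω) := by
    intro y
    rw [gksExpect_sumElim_zero n m K C ((0 : ℝ) • h) hF]
    simp [spinProduct_singleton]
  simp only [hre, secondMoment, Matrix.mulVec, dotProduct, Matrix.of_apply]
  exact Finset.sum_congr rfl fun y _ => by ring


/-- **D2 · linearisation at zero field — PROVED (v3).**  MDP for `(K, C)` implies the strict linear domination
principle for the zero-field second-moment matrix `Σ`: if `(Σg)_x < 0` at every `x` with `g_x > 0` then `Σg ≤ 0`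
everywhere.  Proof: put `g = g⁺ − g⁻` (disjoint nonnegative parts) and `F_y(t) := m_y(t g⁺) − m_y(t g⁻)`; by
`hasDerivAt_mag_smul_zero` (`⟨σ_y⟩₀ = 0`, `gksSum_spinAt_eq_zero_of_even_supp`; field derivative = truncated
correlation, `hasDerivAt_gksExpect_cplAt_cov_spinProduct`; reindexing `gksExpect_sumElim_zero`) `F_y(0) = 0` and
`F_y'(0) = (Σg)_y`.  Hence for all small `t > 0` the MDP hypothesis holds strictly at every source (`Filter.eventually_all`
over the finite site set), MDP gives `F_x(t) ≤ 0`, and `(Σg)_x = lim_{t↓0} F_x(t)/t ≤ 0` (`le_of_tendsto`).  The name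
`stub_` is kept only because the registry recorded it; it is no longer a stub. [folklore] -/
theorem stub_mdp_linearise :
    ∀ (n m : ℕ) (K : Fin m → ℝ) (C : Fin m → Finset (Fin n)), (∀ i, 0 ≤ K i) → (∀ i, (C i).card = 2) →
      (∀ A B : Fin n → ℝ, (∀ x, 0 ≤ A x) → (∀ x, 0 ≤ B x) → (∀ x, A x = 0 ∨ B x = 0) →
        (∀ x, 0 < A x →
          gksExpect (Finset.univ : Finset (Fin m ⊕ Fin n)) (Sum.elim K A)
              (Sum.elim C fun y => ({y} : Finset (Fin n))) (spinAt x) ≤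
            gksExpect (Finset.univ : Finset (Fin m ⊕ Fin n)) (Sum.elim K B)
              (Sum.elim C fun y => ({y} : Finset (Fin n))) (spinAt x)) →
        ∀ x,
          gksExpect (Finset.univ : Finset (Fin m ⊕ Fin n)) (Sum.elim K A)
              (Sum.elim C fun y => ({y} : Finset (Fin n))) (spinAt x) ≤
            gksExpect (Finset.univ : Finset (Fin m ⊕ Fin n)) (Sum.elim K B)
              (Sum.elim C fun y => ({y} : Finset (Fin n))) (spinAt x)) →
      ∀ g : Fin n → ℝ,
        (∀ x, 0 < g x →
          (Matrix.of fun (p q : Fin n) => gksExpect Finset.univ K C (fun ω => spinAt p ω * spinAt q ω)).mulVec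
            g x < 0) →
        ∀ x, (Matrix.of fun (p q : Fin n) => gksExpect Finset.univ K C (fun ω => spinAt p ω * spinAt q ω)).mulVec
            g x ≤ 0 := by
  intro n m K C _hK hC hMDP g hg x
  have hg' : ∀ z, 0 < g z → (secondMoment n m K C).mulVec g z < 0 := hg
  change (secondMoment n m K C).mulVec g x ≤ 0
  set gp : Fin n → ℝ := fun y => max (g y) 0 with hgp
  set gm : Fin n → ℝ := fun y => max (-g y) 0 with hgm
  have hgpm : gp - gm = g := by
    funext y
    simp only [Pi.sub_apply, hgp, hgm]
    rcases le_total 0 (g y) with h0 | h0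
    · rw [max_eq_left h0, max_eq_right (by linarith)]; ring
    · rw [max_eq_right h0, max_eq_left (by linarith)]; ring
  -- the one-parameter family and its derivative at 0
  have hder : ∀ y, HasDerivAt (fun t : ℝ => mag n m K C (t • gp) y - mag n m K C (t • gm) y)
      ((secondMoment n m K C).mulVec g y) 0 := by
    intro y
    have h := (hasDerivAt_mag_smul_zero n m K C hC gp y).sub (hasDerivAt_mag_smul_zero n m K C hC gm y)
    have h2 : (secondMoment n m K C).mulVec gp y - (secondMoment n m K C).mulVec gm y =
        (secondMoment n m K C).mulVec g y := by
      rw [← hgpm, Matrix.mulVec_sub]; rfl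
    exact h.congr_deriv h2
  have hF0 : ∀ y, mag n m K C ((0 : ℝ) • gp) y - mag n m K C ((0 : ℝ) • gm) y = 0 := by
    intro y; simp
  have hslope : ∀ y, Tendsto (fun t : ℝ => t⁻¹ * (mag n m K C (t • gp) y - mag n m K C (t • gm) y))
      (𝓝[>] 0) (𝓝 ((secondMoment n m K C).mulVec g y)) := by
    intro y
    have h := (hder y).tendsto_slope_zero_right
    simpa [zero_add, smul_eq_mul] using h
  have hpos : ∀ᶠ t in 𝓝[>] (0 : ℝ), (0 : ℝ) < t := self_mem_nhdsWithin
  -- strict domination at the sources, for all small t > 0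
  have hevq : ∀ᶠ t in 𝓝[>] (0 : ℝ), ∀ z, 0 < g z →
      mag n m K C (t • gp) z - mag n m K C (t • gm) z < 0 := by
    rw [Filter.eventually_all]
    intro z
    by_cases hz : 0 < g z
    · have hlt := hg' z hz
      have h1 : ∀ᶠ t in 𝓝[>] (0 : ℝ),
          t⁻¹ * (mag n m K C (t • gp) z - mag n m K C (t • gm) z) < 0 :=
        (hslope z).eventually (gt_mem_nhds hlt)
      filter_upwards [h1, hpos] with t ht1 ht2
      intro _
      by_contra hcon
      push_neg at hcon
      exact absurd ht1 (not_lt.mpr (mul_nonneg (inv_nonneg.mpr ht2.le) hcon))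
    · exact Filter.Eventually.of_forall fun t h' => absurd h' hz
  -- MDP at each such t
  have hevall : ∀ᶠ t in 𝓝[>] (0 : ℝ), mag n m K C (t • gp) x - mag n m K C (t • gm) x ≤ 0 := by
    filter_upwards [hevq, hpos] with t ht htpos
    have hA : ∀ z, 0 ≤ (t • gp) z := fun z => by
      simp only [Pi.smul_apply, smul_eq_mul, hgp]; exact mul_nonneg htpos.le (le_max_right _ _)
    have hB : ∀ z, 0 ≤ (t • gm) z := fun z => by
      simp only [Pi.smul_apply, smul_eq_mul, hgm]; exact mul_nonneg htpos.le (le_max_right _ _)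
    have hdisj : ∀ z, (t • gp) z = 0 ∨ (t • gm) z = 0 := by
      intro z
      simp only [Pi.smul_apply, smul_eq_mul, hgp, hgm]
      rcases le_total 0 (g z) with h0 | h0
      · right; rw [max_eq_right (by linarith)]; ring
      · left; rw [max_eq_right h0]; ring
    have hsrc : ∀ z, 0 < (t • gp) z → mag n m K C (t • gp) z ≤ mag n m K C (t • gm) z := by
      intro z hz'
      have hz1 : 0 < max (g z) 0 := by
        simp only [Pi.smul_apply, smul_eq_mul, hgp] at hz'
        exact (mul_pos_iff_of_pos_left htpos).mp hz'
      have hgz : 0 < g z := by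
        rcases lt_max_iff.mp hz1 with h0 | h0
        · exact h0
        · exact absurd h0 (lt_irrefl _)
      have := ht z hgz
      linarith
    have hres := hMDP (t • gp) (t • gm) hA hB hdisj hsrc x
    change mag n m K C (t • gp) x ≤ mag n m K C (t • gm) x at hres
    linarith
  have hev3 : ∀ᶠ t in 𝓝[>] (0 : ℝ), t⁻¹ * (mag n m K C (t • gp) x - mag n m K C (t • gm) x) ≤ 0 := by
    filter_upwards [hevall, hpos] with t ht htpos
    exact mul_nonpos_of_nonneg_of_nonpos (inv_nonneg.mpr htpos.le) ht
  exact le_of_tendsto (hslope x) hev3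


/-- **D3 · domination principle ⇒ Z-inverse** (PROVED here; S-sized linear algebra; the Choquet–Deny
direction of the classical equivalence "kernel satisfies the domination principle ⇔ its inverse is a Z-matrix").
For ANY real square matrix `S` with the domination principle, `S⁻¹ x y ≤ 0` for `x ≠ y`: if `S` is singular,
`S⁻¹ = 0` (`Matrix.nonsing_inv_apply_not_isUnit`); otherwise test `g = S⁻¹(e_x − τ e_y)` with
`τ = |S⁻¹ xx| / S⁻¹ xy + 1`: then `g_x < 0`, the hypothesis holds at every `z ≠ x` because
`(Sg)_z = [z = x] − τ[z = y] ≤ 0`, and the conclusion `(Sg)_x = 1 ≤ 0` is absurd. [folklore] -/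
theorem dp_inverse_offdiag_nonpos :
    ∀ (n : ℕ) (S : Matrix (Fin n) (Fin n) ℝ),
      (∀ g : Fin n → ℝ, (∀ x, 0 < g x → S.mulVec g x ≤ 0) → ∀ x, S.mulVec g x ≤ 0) →
      ∀ x y : Fin n, x ≠ y → S⁻¹ x y ≤ 0 := by
  intro n S hdp x y hxy
  by_cases hS : IsUnit S.det
  · by_contra hpos'
    have hpos : 0 < S⁻¹ x y := lt_of_not_ge hpos'
    set τ : ℝ := |S⁻¹ x x| / S⁻¹ x y + 1 with hτ
    have hτpos : 0 < τ := by
      have : 0 ≤ |S⁻¹ x x| / S⁻¹ x y := div_nonneg (abs_nonneg _) hpos.le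
      linarith
    set v : Fin n → ℝ := Pi.single x 1 - τ • Pi.single y 1 with hv
    set g : Fin n → ℝ := S⁻¹.mulVec v with hg
    have hSg : S.mulVec g = v := by
      rw [hg, Matrix.mulVec_mulVec, Matrix.mul_nonsing_inv _ hS, Matrix.one_mulVec]
    have hvx : v x = 1 := by
      simp [hv, hxy]
    have hvz : ∀ z, z ≠ x → v z ≤ 0 := by
      intro z hz
      by_cases hzy : z = y
      · subst hzy
        simp [hv, hz, hτpos.le]
      · simp [hv, hz, hzy]
    have hgx : g x = S⁻¹ x x - τ * S⁻¹ x y := by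
      simp [hg, hv, Matrix.mulVec_sub, Matrix.mulVec_smul, Pi.sub_apply, Pi.smul_apply, smul_eq_mul, mul_comm]
    have hgx_neg : g x < 0 := by
      have h1 : τ * S⁻¹ x y = |S⁻¹ x x| + S⁻¹ x y := by
        rw [hτ]; field_simp
      have h2 : S⁻¹ x x ≤ |S⁻¹ x x| := le_abs_self _
      rw [hgx, h1]; linarith
    have hyp : ∀ z, 0 < g z → S.mulVec g z ≤ 0 := by
      intro z hz
      rw [hSg]
      by_cases hzx : z = x
      · subst hzx; exact absurd hz (not_lt.mpr hgx_neg.le)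
      · exact hvz z hzx
    have := hdp g hyp x
    rw [hSg, hvx] at this
    linarith
  · rw [Matrix.nonsing_inv_apply_not_isUnit _ hS]
    simp

/-- **D3′ · strict domination principle ⇒ Z-inverse** (PROVED; the version the composition uses: the strict
hypothesis is what first-order linearisation of MDP delivers). [folklore] -/
theorem dpStrict_inverse_offdiag_nonpos :
    ∀ (n : ℕ) (S : Matrix (Fin n) (Fin n) ℝ),
      (∀ g : Fin n → ℝ, (∀ x, 0 < g x → S.mulVec g x < 0) → ∀ x, S.mulVec g x ≤ 0) →
      ∀ x y : Fin n, x ≠ y → S⁻¹ x y ≤ 0 := by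
  intro n S hdp x y hxy
  by_cases hS : IsUnit S.det
  · by_contra hpos
    push_neg at hpos
    set σ : ℝ := ∑ z, S⁻¹ x z with hσ
    set τ : ℝ := 1 + (|σ| + 2 * |S⁻¹ x x| + 1) / S⁻¹ x y with hτ
    have hτpos : 0 < τ := by
      have : 0 ≤ (|σ| + 2 * |S⁻¹ x x| + 1) / S⁻¹ x y := by positivity
      linarith
    set v : Fin n → ℝ := (2 : ℝ) • Pi.single x 1 + (1 - τ) • Pi.single y 1 - 1 with hv
    set g : Fin n → ℝ := S⁻¹.mulVec v with hg
    have hSg : S.mulVec g = v := by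
      rw [hg, Matrix.mulVec_mulVec, Matrix.mul_nonsing_inv _ hS, Matrix.one_mulVec]
    have hvx : v x = 1 := by
      simp [hv, Pi.single_apply, hxy]; norm_num
    have hvz : ∀ z, z ≠ x → v z < 0 := by
      intro z hz
      by_cases hzy : z = y
      · subst hzy
        simp [hv, Pi.single_apply, hz]
        linarith
      · simp [hv, Pi.single_apply, hz, hzy]
    have hgx : g x = 2 * S⁻¹ x x + (1 - τ) * S⁻¹ x y - σ := by
      simp [hg, hv, hσ, Matrix.mulVec_sub, Matrix.mulVec_add, Matrix.mulVec_smul, Pi.sub_apply, Pi.add_apply,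
        Pi.smul_apply, smul_eq_mul, Matrix.mulVec, dotProduct, Pi.single_apply, Finset.sum_ite_eq', mul_comm]
    have hgx_neg : g x < 0 := by
      have h1 : (1 - τ) * S⁻¹ x y = -(|σ| + 2 * |S⁻¹ x x| + 1) := by
        rw [hτ]; field_simp; ring
      have h2 : S⁻¹ x x ≤ |S⁻¹ x x| := le_abs_self _
      have h3 : -σ ≤ |σ| := neg_le_abs _
      rw [hgx, h1]; linarith
    have hyp : ∀ z, 0 < g z → S.mulVec g z < 0 := by
      intro z hz
      rw [hSg]
      by_cases hzx : z = x
      · subst hzx; exact absurd hz (not_lt.mpr hgx_neg.le)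
      · exact hvz z hzx
    have := hdp g hyp x
    rw [hSg, hvx] at this
    linarith
  · rw [Matrix.nonsing_inv_apply_not_isUnit _ hS]
    simp

/-- **Rung-3 lemma target (ALIGN-R), typed; NOT a stub, not used by the composition.**  For a pair
ferromagnet, a background field `g` of ANY sign and an increment `h ≥ 0`, aligning the background to `+` can only
decrease the response of `⟨σ_o⟩` to the increment:
`m_o(|g|+h) − m_o(|g|−h) ≤ m_o(g+h) − m_o(g−h)`.  Equivalent (given GHS) to the three-flip inequality (Δ₃)
`E[σ_x|+++] ≤ E[σ_x|++−] + E[σ_x|+−+] + E[σ_x|−++]` and to MDP's rung-3 sign condition; it is the lower face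
complementary to the Ding–Song–Sun inequality `m_o(g+h) − m_o(g−h) ≤ m_o(h) − m_o(−h)` (arXiv:2107.09243, Thm 1.1),
and the joint generalisation over `|g₁| ≥ |g₂|` is false (ibid. Rem. 1.2).  Numerically clean (card §Rung structure);
fails for 4-body interactions.  [conjecture of this line; cite: DingSongSun2023 for the neighbouring theorem] -/
def AlignR : Prop :=
  ∀ (n m : ℕ) (K : Fin m → ℝ) (C : Fin m → Finset (Fin n)), (∀ i, 0 ≤ K i) → (∀ i, (C i).card = 2) →
    ∀ (g h : Fin n → ℝ), (∀ y, 0 ≤ h y) → ∀ o : Fin n,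
      mag n m K C (fun y => |g y| + h y) o - mag n m K C (fun y => |g y| - h y) o ≤
        mag n m K C (fun y => g y + h y) o - mag n m K C (fun y => g y - h y) o

/-- **(ALIGN)**, the `h → 0⁺` derivative of `AlignR`: aligning the field decreases every truncated two-point function,
`⟨σ_x; σ_y⟩_{|g|} ≤ ⟨σ_x; σ_y⟩_g`.  With GHS it gives `a ≥ |b| ⇒ ⟨σ_x;σ_y⟩_a ≤ ⟨σ_x;σ_y⟩_b`.  Typed target, not a stub.
[conjecture of this line] -/
def Align : Prop :=
  ∀ (n m : ℕ) (K : Fin m → ℝ) (C : Fin m → Finset (Fin n)), (∀ i, 0 ≤ K i) → (∀ i, (C i).card = 2) →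
    ∀ (g : Fin n → ℝ) (x y : Fin n),
      gksExpect (Finset.univ : Finset (Fin m ⊕ Fin n)) (Sum.elim K fun z => |g z|) (Sum.elim C fun z => ({z} : Finset (Fin n)))
          (fun ω => spinAt x ω * spinAt y ω) -
        mag n m K C (fun z => |g z|) x * mag n m K C (fun z => |g z|) y ≤
      gksExpect (Finset.univ : Finset (Fin m ⊕ Fin n)) (Sum.elim K g) (Sum.elim C fun z => ({z} : Finset (Fin n)))
          (fun ω => spinAt x ω * spinAt y ω) -
        mag n m K C g x * mag n m K C g y

/-- **(ALIGN-β)**, the sharpest form of the rung-3 lemma (equivalent to the three-flip inequality (Δ₃), i.e. to `AlignR`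
with a single-site infinite increment): the REGRESSION COEFFICIENT `β_{o|q} := Cov(σ_o,σ_q)/Var(σ_q)` is minimised by aligning
the field, `β_{o|q}(|g|) ≤ β_{o|q}(g)`; written division-free.  (Ding–Song–Sun Thm 1.1 with `h = ∞·e_q` is the upper face
`β_{o|q}(g) ≤ β_{o|q}(0) = ⟨σ_oσ_q⟩_0`.)  Numerically 0/10 560 (exp/beta_align.py).  Typed target, not a stub.
[conjecture of this line] -/
def AlignBeta : Prop :=
  ∀ (n m : ℕ) (K : Fin m → ℝ) (C : Fin m → Finset (Fin n)), (∀ i, 0 ≤ K i) → (∀ i, (C i).card = 2) →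
    ∀ (g : Fin n → ℝ) (o q : Fin n),
      (gksExpect (Finset.univ : Finset (Fin m ⊕ Fin n)) (Sum.elim K fun z => |g z|) (Sum.elim C fun z => ({z} : Finset (Fin n)))
            (fun ω => spinAt o ω * spinAt q ω) - mag n m K C (fun z => |g z|) o * mag n m K C (fun z => |g z|) q) *
        (1 - mag n m K C g q * mag n m K C g q) ≤
      (gksExpect (Finset.univ : Finset (Fin m ⊕ Fin n)) (Sum.elim K g) (Sum.elim C fun z => ({z} : Finset (Fin n)))
            (fun ω => spinAt o ω * spinAt q ω) - mag n m K C g o * mag n m K C g q) *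
        (1 - mag n m K C (fun z => |g z|) q * mag n m K C (fun z => |g z|) q)

/-- `mag` is the displayed `gksExpect` (bookkeeping for readers of the card; not a stub). [folklore] -/
theorem mag_eq (n m : ℕ) (K : Fin m → ℝ) (C : Fin m → Finset (Fin n)) (h : Fin n → ℝ) (x : Fin n) :
    mag n m K C h x = gksExpect (Finset.univ : Finset (Fin m ⊕ Fin n)) (Sum.elim K h)
      (Sum.elim C fun y => ({y} : Finset (Fin n))) (spinAt x) := rfl

/-- **`InverseMFerromagnet_of`** — the crux BY NAME: D1 (MDP, the one remaining stub) ⇒ D2 (strict domination principle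
for `Σ`, PROVED) ⇒ D3′ (`Σ⁻¹` has nonpositive off-diagonal entries, PROVED). [folklore] -/
theorem InverseMFerromagnet_of : InverseMFerromagnet := by
  intro n m K C hK hC x y hxy
  exact dpStrict_inverse_offdiag_nonpos n _ (stub_mdp_linearise n m K C hK hC (stub_mdp n m K C hK hC)) x y hxy

end

end Summit.CriticalPhenomena.Ising3DConformalLimit.Cruxes.InverseMFerromagnet.MagnetizationDomination
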